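/-
Copyright (c) 2026 the pub-hodgecm-mathlib formalisation cell (harness21).  Prover seat hodgecm-mathlib-K2E3-p23 (g7), Track B «K2-LIT» ∕ hLiu418, organ F4 (G-gen),
road (E), brick (E-g) «POLYNOMIAL PARTNER» — THE LINEAR-ALGEBRA ∕ TOPOLOGY CORE, HYPOTHESIS-FIRST (K2E5-r02 (g6) (F-i) steps (1)–(4), 2026-09-04T23:16:26Z).
THEOREMS ONLY.
-/
import Mathlib.Topology.Algebra.Module.FiniteDimension
import Mathlib.Analysis.Complex.Basic
import HarnessLib

/-!
# Crux `HLiu418`, organ F4 (G-gen), road (E), brick (E-g) core: A LIMIT OF VECTORS WHOSE IMAGES STAY IN ONE FINITE-DIMENSIONAL SUBSPACE HAS A PARTNER —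
# `T a = T w` for some `w` in the approximating family's submodule (finite-dimensional subspaces are closed)

Cell `hodgecm-mathlib`, crux item hLiu418 = `stmt-HodgeConjecture-24832` (helper lane `--kind proof --supports stmt-HodgeConjecture-24832 --as helper`, count-neutral;
closes no socket); squad K2 ∕ K2Liu; LEAD F0P6-plan (g14); F4 lead K2Liu-p27 (g2); box K2E5-r02 (g6); prover K2E3-p23 (g7).  THEOREMS ONLY (no `def`, no `instance`,
no notation, no named-fact hypothesis, no `sorry`); pure Mathlib.

WHY (r02 (F-i), the «polynomial partner» (E-g) `exists_fockFinite_partner`).  For a finite-dimensional `K̃_∞`-stable `V ⊂ 𝓢_∞` and `a ∈ V`, the degree truncations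
`Π_{≤D} a` are Fock-finite, converge to `a` in `𝓢` (★ `hasSum_degProjS`), stay inside the finite set `F` of `K̃`-types of `V` (★ `degProjS_hermiteBlockCLM_comm`), and
`SW_∞` is continuous; the ONE finiteness input is «`SW_∞(𝓢_{∞,F})` is finite-dimensional» (Iwasawa + matrix coefficients).  THIS FILE is the abstract conclusion, so
that the (E-g) owner only instantiates: for a continuous linear `T : E →L[𝕜] G` into a Hausdorff topological vector space, a submodule `P ≤ E` («Fock-finite»), a
submodule `SF ≤ E` («types in `F`») WITH `T(SF)` FINITE-DIMENSIONAL (the letter, by value), and a net `v i → a` with `v i ∈ P ⊓ SF` eventually: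
* `map_mem_of_tendsto_of_finiteDimensional` — `T a ∈ W` for every finite-dimensional `W` containing the `T (v i)` eventually (★ Mathlib `Submodule.closed_of_finiteDimensional`
  + `IsClosed.mem_of_tendsto`);
* **`exists_partner_of_tendsto`** — `∃ w ∈ P, w ∈ SF ∧ T w = T a` (apply the first to `W := (P ⊓ SF).map T ≤ SF.map T`).
* `exists_partner_of_tendsto_seq` — the `ℕ`-indexed sequence form (degree truncations `D ↦ Π_{≤D} a`).
References: [Folland1989] §1.7 (Hermite expansions in `𝓢`); [Howe1989] §3; [Rudin1991] Thm. 1.21 (finite-dimensional subspaces are closed).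
HONEST LABEL.  Count-neutral helper, pure topology ∕ linear algebra; the analytic letters (convergence of truncations, type-stability, continuity of `SW_∞`, and the
finite-dimensionality of `SW_∞(𝓢_{∞,F})`) stay BY VALUE with the (E-g) owner.  `HC_CM` is proved only modulo the 7 printed citations (2 remaining named inputs: hLiu418 =
`stmt-HodgeConjecture-24832`, h413 = `stmt-HodgeConjecture-24833`) until rung 0 closes.
-/

set_option autoImplicit false
set_option linter.dupNamespace false -- the mandated namespace repeats `HodgeConjecture.HodgeConjecture`

open Filter Topology

namespace Summit.HodgeConjecture.HodgeConjecture.Cruxes.HLiu418.K2LiuFockFinitePartnerOfClosedRange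

variable {𝕜 : Type*} [NontriviallyNormedField 𝕜] [CompleteSpace 𝕜]
  {E : Type*} [AddCommGroup E] [Module 𝕜 E] [TopologicalSpace E]
  {G : Type*} [AddCommGroup G] [Module 𝕜 G] [TopologicalSpace G] [IsTopologicalAddGroup G] [ContinuousSMul 𝕜 G] [T2Space G]

/-- **The image of a limit lies in every finite-dimensional subspace that eventually contains the images** (finite-dimensional subspaces of a Hausdorff topological
vector space over a complete field are closed). [cite: Rudin1991, Thm. 1.21] -/
theorem map_mem_of_tendsto_of_finiteDimensional (T : E →L[𝕜] G) (W : Submodule 𝕜 G) [FiniteDimensional 𝕜 W]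
    {ι : Type*} {l : Filter ι} [l.NeBot] {v : ι → E} {a : E} (hv : Tendsto v l (𝓝 a)) (hvW : ∀ᶠ i in l, T (v i) ∈ W) :
    T a ∈ W :=
  W.closed_of_finiteDimensional.mem_of_tendsto ((T.continuous.tendsto a).comp hv) hvW

/-- **THE PARTNER** (core of (E-g) «polynomial partner»): if `v i → a` with `v i ∈ P` and `v i ∈ SF` eventually, and `T(SF)` is finite-dimensional (BY VALUE), then some
`w ∈ P ⊓ SF` has `T w = T a` — apply the previous lemma to `W := (P ⊓ SF).map T`, finite-dimensional as a subspace of `SF.map T`.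
[cite: Rudin1991, Thm. 1.21] [cite: Folland1989, §1.7] [cite: Howe1989, §3] -/
theorem exists_partner_of_tendsto (T : E →L[𝕜] G) (P SF : Submodule 𝕜 E) (hfin : FiniteDimensional 𝕜 ↥(SF.map (T : E →ₗ[𝕜] G)))
    {ι : Type*} {l : Filter ι} [l.NeBot] {v : ι → E} {a : E} (hv : Tendsto v l (𝓝 a))
    (hvP : ∀ᶠ i in l, v i ∈ P) (hvS : ∀ᶠ i in l, v i ∈ SF) :
    ∃ w ∈ P, w ∈ SF ∧ T w = T a := by
  haveI : FiniteDimensional 𝕜 ↥((P ⊓ SF).map (T : E →ₗ[𝕜] G)) :=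
    Submodule.finiteDimensional_of_le (Submodule.map_mono inf_le_right)
  have hmem : T a ∈ (P ⊓ SF).map (T : E →ₗ[𝕜] G) :=
    map_mem_of_tendsto_of_finiteDimensional T _ hv
      ((hvP.and hvS).mono fun i hi => ⟨v i, ⟨hi.1, hi.2⟩, rfl⟩)
  obtain ⟨w, ⟨hwP, hwS⟩, hw⟩ := hmem
  exact ⟨w, hwP, hwS, hw⟩

/-- **Sequence form** (the degree truncations `D ↦ Π_{≤D} a`): `v : ℕ → E`, `v D → a`, every `v D ∈ P ⊓ SF`, `T(SF)` finite-dimensional ⇒ a partner `w ∈ P ⊓ SF` with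
`T w = T a`. [cite: Folland1989, §1.7] [cite: Rudin1991, Thm. 1.21] -/
theorem exists_partner_of_tendsto_seq (T : E →L[𝕜] G) (P SF : Submodule 𝕜 E) (hfin : FiniteDimensional 𝕜 ↥(SF.map (T : E →ₗ[𝕜] G)))
    {v : ℕ → E} {a : E} (hv : Tendsto v atTop (𝓝 a)) (hvP : ∀ D, v D ∈ P) (hvS : ∀ D, v D ∈ SF) :
    ∃ w ∈ P, w ∈ SF ∧ T w = T a :=
  exists_partner_of_tendsto T P SF hfin hv (Eventually.of_forall hvP) (Eventually.of_forall hvS)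

end Summit.HodgeConjecture.HodgeConjecture.Cruxes.HLiu418.K2LiuFockFinitePartnerOfClosedRange
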